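import Mathlib
import HarnessLib
import Summits.ValiantsHypothesis.ValiantsHypothesis.Theorems.MonotoneRestorationOrbitRestorationQPBipartiteSplitting
import Summits.ValiantsHypothesis.ValiantsHypothesis.Theorems.MonotoneRestorationMonotoneRestorationQPLinearWidthOrbitSeparation

/-!
# The exact per-level witness criterion of the kill instruments: a pair of simple graphs is separated by SOME matrix-symmetric
# polynomial iff their adjacency relations are NOT aligned
(crux `OrbitRestorationQP`, stmt-ValiantsHypothesis-18293, and the cruxes 16191 / 15886)

Namespace `Summit.ValiantsHypothesis.ValiantsHypothesis.Theorems.OrbitRestorationQPDepthThreeRung.BipartiteSplitting`.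
Definition-free.

`…BipartiteSplitting.lean` (`no_alignment_of_eval_ne`): a pair `X, Y` of simple graphs on `Fin m` separated by a matrix-symmetric
polynomial admits no alignment `X.Adj (σ i) (τ j) ↔ Y.Adj i j`.  The converse is orbit separation for the finite group
`Sym_m × Sym_m` acting on `ℂ^{m×m}` (`OrbitSeparation.exists_matrixSymmetric_separating`, the Reynolds sum of a Lagrange
interpolant, landed on line `linear-width` of crux 15886).  Together:

* `aligned_iff_indicator_perm` — alignment of the adjacency relations is the statement that the `0/1` adjacency matrix of `Y`
  is a row/column permutation of that of `X`;
* `exists_matrixSymmetric_eval_ne_iff_not_aligned` — **at every level `m`, SOME matrix-symmetric `q ∈ ℂ[x_ij]` (of degree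
  `< 2·(m!)²`) takes different values on the adjacency matrices of `X` and `Y` iff the pair is not aligned** — so the pairs
  usable in the separation clause of `RungKill.restorationOn_false_of_separating` / `not_qpOrbitSymmetric_of_polylogSeparating`
  are EXACTLY the non-aligned ones (equivalently: non-isomorphic bipartite splittings / double covers with marked sides), and
  the whole content of a refutation is to separate infinitely many such `C^{polylog}`-equivalent pairs by ONE family inside the
  class (`PDClass 1` for A_∞, `VP` for the crux);
* `forall_matrixSymmetric_eval_eq_iff_aligned` — the contrapositive packaging.

Honest label: refuter-side bookkeeping; no stub closed; VP ≠ VNP untouched. [folklore]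
-/

noncomputable section

open scoped Classical

-- `Summit.ValiantsHypothesis.ValiantsHypothesis.…` is the tree's single-conjunct layout (Sub = Summit).
set_option linter.dupNamespace false

namespace Summit.ValiantsHypothesis.ValiantsHypothesis.Theorems.OrbitRestorationQPDepthThreeRung.BipartiteSplitting

open MvPolynomial Equiv Summit.ValiantsHypothesis.ValiantsHypothesis.Theorems

/-- Alignment of the adjacency relations of `X` and `Y` by `(σ, τ)` is the statement that the `0/1` adjacency matrix of `Y` is
the `(σ, τ)`-permutation of that of `X`. [folklore] -/
theorem aligned_iff_indicator_perm {m : ℕ} (X Y : SimpleGraph (Fin m)) (σ τ : Perm (Fin m)) :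
    (∀ i j, X.Adj (σ i) (τ j) ↔ Y.Adj i j) ↔
      (Set.indicator {ij : Fin m × Fin m | Y.Adj ij.1 ij.2} (1 : Fin m × Fin m → ℂ)) =
        fun ij : Fin m × Fin m =>
          Set.indicator {ij : Fin m × Fin m | X.Adj ij.1 ij.2} (1 : Fin m × Fin m → ℂ) (σ ij.1, τ ij.2) := by
  constructor
  · intro h
    funext ij
    by_cases hY : Y.Adj ij.1 ij.2
    · have hX : X.Adj (σ ij.1) (τ ij.2) := (h ij.1 ij.2).2 hY
      rw [Set.indicator_of_mem (show ij ∈ {ij : Fin m × Fin m | Y.Adj ij.1 ij.2} from hY),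
        Set.indicator_of_mem (show ((σ ij.1, τ ij.2) : Fin m × Fin m) ∈ {ij : Fin m × Fin m | X.Adj ij.1 ij.2} from hX)]
      rfl
    · have hX : ¬ X.Adj (σ ij.1) (τ ij.2) := fun hX => hY ((h ij.1 ij.2).1 hX)
      rw [Set.indicator_of_notMem (show ij ∉ {ij : Fin m × Fin m | Y.Adj ij.1 ij.2} from hY),
        Set.indicator_of_notMem (show ((σ ij.1, τ ij.2) : Fin m × Fin m) ∉ {ij : Fin m × Fin m | X.Adj ij.1 ij.2} from hX)]
  · intro h i j
    have hij := congrFun h (i, j)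
    dsimp only at hij
    constructor
    · intro hX
      by_contra hY
      rw [Set.indicator_of_notMem (show ((i, j) : Fin m × Fin m) ∉ {ij : Fin m × Fin m | Y.Adj ij.1 ij.2} from hY),
        Set.indicator_of_mem (show ((σ i, τ j) : Fin m × Fin m) ∈ {ij : Fin m × Fin m | X.Adj ij.1 ij.2} from hX)] at hij
      exact one_ne_zero hij.symm
    · intro hY
      by_contra hX
      rw [Set.indicator_of_mem (show ((i, j) : Fin m × Fin m) ∈ {ij : Fin m × Fin m | Y.Adj ij.1 ij.2} from hY),
        Set.indicator_of_notMem (show ((σ i, τ j) : Fin m × Fin m) ∉ {ij : Fin m × Fin m | X.Adj ij.1 ij.2} from hX)] at hij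
      exact one_ne_zero hij

/-- **THE WITNESS CRITERION.**  For simple graphs `X`, `Y` on `Fin m`: some polynomial `q ∈ ℂ[x_ij : i,j<m]` invariant under
independent row and column permutations takes different values on the two adjacency matrices iff NO pair of permutations aligns
the adjacency relations; the separating `q` can be taken of total degree `< 2·(m!)²`. [folklore] -/
theorem exists_matrixSymmetric_eval_ne_iff_not_aligned {m : ℕ} (X Y : SimpleGraph (Fin m)) :
    (∃ q : MvPolynomial (Fin m × Fin m) ℂ,
      (∀ σ τ : Perm (Fin m), rename (fun ij : Fin m × Fin m => (σ ij.1, τ ij.2)) q = q) ∧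
      eval (Set.indicator {ij : Fin m × Fin m | X.Adj ij.1 ij.2} 1) q ≠
        eval (Set.indicator {ij : Fin m × Fin m | Y.Adj ij.1 ij.2} 1) q ∧
      q.totalDegree < 2 * (Nat.factorial m) ^ 2) ↔
    ¬ ∃ σ τ : Perm (Fin m), ∀ i j, X.Adj (σ i) (τ j) ↔ Y.Adj i j := by
  constructor
  · rintro ⟨q, hq, hne, -⟩
    exact no_alignment_of_eval_ne q hq X Y hne
  · intro hna
    refine OrbitSeparation.exists_matrixSymmetric_separating _ _ fun σ τ hB => hna ⟨σ, τ, ?_⟩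
    exact (aligned_iff_indicator_perm X Y σ τ).2 hB

/-- Contrapositive packaging: ALL matrix-symmetric polynomials agree on the two adjacency matrices iff the pair is aligned.
[folklore] -/
theorem forall_matrixSymmetric_eval_eq_iff_aligned {m : ℕ} (X Y : SimpleGraph (Fin m)) :
    (∀ q : MvPolynomial (Fin m × Fin m) ℂ,
      (∀ σ τ : Perm (Fin m), rename (fun ij : Fin m × Fin m => (σ ij.1, τ ij.2)) q = q) →
      eval (Set.indicator {ij : Fin m × Fin m | X.Adj ij.1 ij.2} 1) q =
        eval (Set.indicator {ij : Fin m × Fin m | Y.Adj ij.1 ij.2} 1) q) ↔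
    ∃ σ τ : Perm (Fin m), ∀ i j, X.Adj (σ i) (τ j) ↔ Y.Adj i j := by
  constructor
  · intro h
    by_contra hna
    obtain ⟨q, hq, hne, -⟩ := (exists_matrixSymmetric_eval_ne_iff_not_aligned X Y).2 hna
    exact hne (h q hq)
  · rintro ⟨σ, τ, hal⟩ q hq
    exact eval_indicator_eq_of_adj_iff q hq X Y σ τ hal

end Summit.ValiantsHypothesis.ValiantsHypothesis.Theorems.OrbitRestorationQPDepthThreeRung.BipartiteSplitting

end
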